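import Mathlib
import HarnessLib.Audit
import Summits.PneNP.PneNP.Theorems.ClusUniversalCertificateCubeA

/-!
# Route ClusUniversalCertificate — echelon pivots and the lex split of a subspace (hilbert-TII.md Corollary 4)
(rung F-N1, cell pnp-ideate, crux `UniversalCertAll` = stmt-PneNP-19683; planner p1 g13, `HOME/pnp-ideate-p1/lines/hilbert-TII.md` §1 Cor 4,
task §6 T1; linear algebra over `𝔽₂` — nothing here bears on `P` versus `NP`)

Tools for `ClusHilbertBound.tii`.  Points `V N = Fin N → 𝔽₂` (`ClusCube.V`).

* `exists_echelon` — every subspace `W ≤ 𝔽₂^N` has pivot coordinates `L` and pivot vectors `b t ∈ W` (`t ∈ L`) with leading one exactly at `t`,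
  spanning `W` (reduction by descending leading coordinate; no linear independence is needed downstream);
* `echelon_combination_apply` — a combination of pivots vanishes before its first active pivot and equals the coefficient there;
* `lex_split` (Corollary 4 of the notes) — relative to a point `y`, `W` splits into `U₁ = ⟨pivots leading at a 0 of y⟩` (every non-zero vector has
  its leading one at a `0` of `y`: LEX-INCREASING at `y`) and `U₂ = ⟨pivots leading at a 1 of y⟩` (LEX-DECREASING), with `dim W ≤ dim U₁ + dim U₂`;
* `lexRank`, `lexRank_lt_of_lead_zero`, `lexRank_add_lt_of_lead_one` — the lexicographic rank (`Pi.Lex` on `Fin N → ℕ` through `ZMod.val`) and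
  the two monotonicity facts the split feeds to `ClusHilbertBound.sum_finrank_le_sum_predErr`.
-/

set_option linter.dupNamespace false -- `Summit.PneNP.PneNP.…`: summit = sub-problem name (D-0017 single-conjunct layout)

namespace Summit.PneNP.PneNP.Theorems.ClusHilbert

open Finset
open Summit.PneNP.PneNP.Theorems.ClusCube (V)

variable {N : ℕ}

/-- Every element of `ZMod 2` is `0` or `1`. -/
private theorem zmod2_eq_zero_or_one (z : ZMod 2) : z = 0 ∨ z = 1 := by
  fin_cases z
  · exact Or.inl rfl
  · exact Or.inr rfl

/-! ## Echelon families and the lex split (Corollary 4) -/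

/-- **Echelon pivots.**  Every subspace `W ≤ 𝔽₂^N` has a set `L` of pivot coordinates and pivot vectors `b t ∈ W` (`t ∈ L`) with leading one
exactly at `t` (zero before `t`), such that every `w ∈ W` is a combination of the pivots. -/
theorem exists_echelon (W : Submodule (ZMod 2) (V N)) :
    ∃ L : Finset (Fin N), ∃ b : Fin N → V N,
      (∀ t ∈ L, b t ∈ W ∧ (∀ i, i < t → b t i = 0) ∧ b t t = 1) ∧
      ∀ w ∈ W, ∃ c : Fin N → ZMod 2, w = ∑ t ∈ L, c t • b t := by
  classical
  let L : Finset (Fin N) := univ.filter fun t => ∃ w ∈ W, (∀ i, i < t → w i = 0) ∧ w t = 1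
  have hpiv : ∀ t : Fin N, ∃ v : V N, t ∈ L → (v ∈ W ∧ (∀ i, i < t → v i = 0) ∧ v t = 1) := by
    intro t
    by_cases ht : t ∈ L
    · obtain ⟨w, hw, h0, h1⟩ := (mem_filter.mp ht).2
      exact ⟨w, fun _ => ⟨hw, h0, h1⟩⟩
    · exact ⟨0, fun h => absurd h ht⟩
  choose b hb using hpiv
  refine ⟨L, b, hb, ?_⟩
  -- spanning, by ascending induction on the number of trailing coordinates still unknown
  have key : ∀ m, m ≤ N → ∀ w ∈ W, (∀ i : Fin N, i.val + m < N → w i = 0) → ∃ c : Fin N → ZMod 2, w = ∑ t ∈ L, c t • b t := by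
    intro m
    induction m with
    | zero =>
      intro _ w _ hw0
      refine ⟨0, ?_⟩
      have : w = 0 := funext fun i => hw0 i (by rw [Nat.add_zero]; exact i.isLt)
      rw [this]
      simp
    | succ m ih =>
      intro hm w hw hw0
      set j : Fin N := ⟨N - m - 1, by omega⟩ with hj
      rcases zmod2_eq_zero_or_one (w j) with h0 | h1
      · -- no pivot needed at `j`
        refine ih (by omega) w hw fun i hi => ?_
        by_cases hij : i.val + (m + 1) < N
        · exact hw0 i hij
        · have : i = j := Fin.ext (by rw [hj]; dsimp only; omega)
          rw [this]; exact h0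
      · -- `j` is a pivot coordinate, witnessed by `w` itself
        have hjL : j ∈ L := by
          refine mem_filter.mpr ⟨mem_univ _, w, hw, fun i hi => hw0 i ?_, h1⟩
          have : i.val < j.val := hi
          rw [hj] at this; dsimp only at this; omega
        obtain ⟨hbW, hb0, hb1⟩ := hb j hjL
        have hw1 : ∀ i : Fin N, i.val + m < N → (w - b j) i = 0 := by
          intro i hi
          rw [Pi.sub_apply]
          by_cases hij : i.val + (m + 1) < N
          · have hlt : i < j := Fin.lt_def.mpr (by rw [hj]; dsimp only; omega)
            rw [hw0 i hij, hb0 i hlt, sub_zero]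
          · have : i = j := Fin.ext (by rw [hj]; dsimp only; omega)
            rw [this, h1, hb1, sub_self]
        obtain ⟨c, hc⟩ := ih (by omega) (w - b j) (W.sub_mem hw hbW) hw1
        refine ⟨fun t => c t + if t = j then 1 else 0, ?_⟩
        have hsum : ∑ t ∈ L, (fun t => c t + if t = j then (1 : ZMod 2) else 0) t • b t = (∑ t ∈ L, c t • b t) + b j := by
          simp only [add_smul, sum_add_distrib, ite_smul, one_smul, zero_smul, sum_ite_eq', if_pos hjL]
        rw [hsum, ← hc]
        exact (sub_add_cancel w (b j)).symm
  intro w hw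
  exact key N le_rfl w hw fun i hi => absurd hi (by omega)

/-- In an echelon family, a combination is zero before its first active pivot and equals the coefficient there. -/
theorem echelon_combination_apply {L : Finset (Fin N)} {b : Fin N → V N}
    (hb : ∀ t ∈ L, (∀ i, i < t → b t i = 0) ∧ b t t = 1) {S : Finset (Fin N)} (hS : S ⊆ L) (c : Fin N → ZMod 2)
    {t₀ : Fin N} (ht₀ : t₀ ∈ S) (hmin : ∀ t ∈ S, c t ≠ 0 → t₀ ≤ t) :
    (∀ i, i < t₀ → (∑ t ∈ S, c t • b t) i = 0) ∧ (∑ t ∈ S, c t • b t) t₀ = c t₀ := by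
  constructor
  · intro i hi
    rw [Finset.sum_apply]
    refine sum_eq_zero fun t ht => ?_
    rw [Pi.smul_apply, smul_eq_mul]
    by_cases hc : c t = 0
    · rw [hc, zero_mul]
    · rw [(hb t (hS ht)).1 i (lt_of_lt_of_le hi (hmin t ht hc)), mul_zero]
  · rw [Finset.sum_apply, sum_eq_single_of_mem t₀ ht₀]
    · rw [Pi.smul_apply, smul_eq_mul, (hb t₀ (hS ht₀)).2, mul_one]
    · intro t ht hne
      rw [Pi.smul_apply, smul_eq_mul]
      by_cases hc : c t = 0
      · rw [hc, zero_mul]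
      · rw [(hb t (hS ht)).1 t₀ (lt_of_le_of_ne (hmin t ht hc) (Ne.symm hne)), mul_zero]

/-- the combinations of the pivots indexed by `S`, as a linear map from coefficient vectors -/
def combMap (b : Fin N → V N) (S : Finset (Fin N)) : (Fin N → ZMod 2) →ₗ[ZMod 2] V N where
  toFun c := ∑ t ∈ S, c t • b t
  map_add' c c' := by
    simp only [Pi.add_apply, add_smul, sum_add_distrib]
  map_smul' a c := by
    simp only [Pi.smul_apply, smul_eq_mul, RingHom.id_apply, smul_sum, smul_smul]

/-- Unfolding `combMap`. -/
@[simp] theorem combMap_apply (b : Fin N → V N) (S : Finset (Fin N)) (c : Fin N → ZMod 2) :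
    combMap b S c = ∑ t ∈ S, c t • b t := rfl

/-- **Corollary 4 (the lex split).**  Every subspace `W` splits, relative to a point `y`, into a LEX-INCREASING part `U₁` (every non-zero vector has
its leading one at a `0` of `y`) and a LEX-DECREASING part `U₂` (leading one at a `1` of `y`) with `dim W ≤ dim U₁ + dim U₂`. -/
theorem lex_split (y : V N) (W : Submodule (ZMod 2) (V N)) :
    ∃ U₁ U₂ : Submodule (ZMod 2) (V N), U₁ ≤ W ∧ U₂ ≤ W ∧
      Module.finrank (ZMod 2) W ≤ Module.finrank (ZMod 2) U₁ + Module.finrank (ZMod 2) U₂ ∧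
      (∀ u ∈ U₁, u ≠ 0 → ∃ t, (∀ i, i < t → u i = 0) ∧ u t ≠ 0 ∧ y t = 0) ∧
      (∀ u ∈ U₂, u ≠ 0 → ∃ t, (∀ i, i < t → u i = 0) ∧ u t ≠ 0 ∧ y t ≠ 0) := by
  classical
  obtain ⟨L, b, hb, hspan⟩ := exists_echelon W
  have hb' : ∀ t ∈ L, (∀ i, i < t → b t i = 0) ∧ b t t = 1 := fun t ht => ⟨(hb t ht).2.1, (hb t ht).2.2⟩
  set Lp := L.filter fun t => y t = 0 with hLp
  set Lm := L.filter fun t => y t ≠ 0 with hLm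
  -- the parts
  have hsub : ∀ S : Finset (Fin N), S ⊆ L → LinearMap.range (combMap b S) ≤ W := by
    intro S hS u hu
    obtain ⟨c, rfl⟩ := LinearMap.mem_range.mp hu
    rw [combMap_apply]
    exact Submodule.sum_mem _ fun t ht => Submodule.smul_mem _ _ (hb t (hS ht)).1
  -- the leading one of a non-zero combination
  have hlead : ∀ S : Finset (Fin N), S ⊆ L → ∀ u ∈ LinearMap.range (combMap b S), u ≠ 0 →
      ∃ t ∈ S, (∀ i, i < t → u i = 0) ∧ u t ≠ 0 := by
    intro S hS u hu hu0
    obtain ⟨c, rfl⟩ := LinearMap.mem_range.mp hu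
    rw [combMap_apply] at hu0 ⊢
    set T := S.filter fun t => c t ≠ 0 with hT
    have hTne : T.Nonempty := by
      by_contra hem
      rw [not_nonempty_iff_eq_empty] at hem
      apply hu0
      refine sum_eq_zero fun t ht => ?_
      have : c t = 0 := by
        by_contra hc
        have : t ∈ T := by rw [hT]; exact mem_filter.mpr ⟨ht, hc⟩
        rw [hem] at this
        exact absurd this (by simp)
      rw [this, zero_smul]
    set t₀ := T.min' hTne with ht₀
    have ht₀T : t₀ ∈ T := T.min'_mem hTne
    have ht₀S : t₀ ∈ S := (mem_filter.mp ht₀T).1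
    have hc₀ : c t₀ ≠ 0 := (mem_filter.mp ht₀T).2
    have hmin : ∀ t ∈ S, c t ≠ 0 → t₀ ≤ t := fun t ht hc => T.min'_le t (by rw [hT]; exact mem_filter.mpr ⟨ht, hc⟩)
    obtain ⟨hz, hv⟩ := echelon_combination_apply hb' hS c ht₀S hmin
    exact ⟨t₀, ht₀S, hz, by rw [hv]; exact hc₀⟩
  refine ⟨LinearMap.range (combMap b Lp), LinearMap.range (combMap b Lm), hsub Lp (filter_subset _ _),
    hsub Lm (filter_subset _ _), ?_, ?_, ?_⟩
  · -- `W ≤ U₁ ⊔ U₂`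
    have hle : W ≤ LinearMap.range (combMap b Lp) ⊔ LinearMap.range (combMap b Lm) := by
      intro w hw
      obtain ⟨c, hc⟩ := hspan w hw
      have hsplit : w = combMap b Lp c + combMap b Lm c := by
        rw [combMap_apply, combMap_apply, hLp, hLm, sum_filter_add_sum_filter_not]
        exact hc
      rw [hsplit]
      exact Submodule.add_mem_sup (LinearMap.mem_range_self _ _) (LinearMap.mem_range_self _ _)
    exact (Submodule.finrank_mono hle).trans (Submodule.finrank_add_le_finrank_add_finrank _ _)
  · intro u hu hu0
    obtain ⟨t, ht, hz, hv⟩ := hlead Lp (filter_subset _ _) u hu hu0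
    exact ⟨t, hz, hv, (mem_filter.mp ht).2⟩
  · intro u hu hu0
    obtain ⟨t, ht, hz, hv⟩ := hlead Lm (filter_subset _ _) u hu hu0
    exact ⟨t, hz, hv, (mem_filter.mp ht).2⟩

/-! ## Lex ranks -/

/-- the lexicographic rank of a point (bit order `0 < 1`, coordinate order the identity) -/
def lexRank (y : V N) : Lex (Fin N → ℕ) := toLex fun i => (y i).val

/-- A vector with leading one at a `0` of `y` moves `y` UP in the lex order. -/
theorem lexRank_lt_of_lead_zero {y u : V N} {t : Fin N} (hz : ∀ i, i < t → u i = 0) (hu : u t ≠ 0) (hy : y t = 0) :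
    lexRank y < lexRank (y + u) := by
  refine ⟨t, fun j hj => ?_, ?_⟩
  · show (y j).val = ((y + u) j).val
    rw [Pi.add_apply, hz j hj, add_zero]
  · show (y t).val < ((y + u) t).val
    have hu1 : u t = 1 := (zmod2_eq_zero_or_one (u t)).resolve_left hu
    rw [Pi.add_apply, hy, hu1, zero_add, ZMod.val_zero, ZMod.val_one]
    exact Nat.zero_lt_one

/-- A vector with leading one at a `1` of `y` moves `y` DOWN in the lex order. -/
theorem lexRank_add_lt_of_lead_one {y u : V N} {t : Fin N} (hz : ∀ i, i < t → u i = 0) (hu : u t ≠ 0) (hy : y t ≠ 0) :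
    lexRank (y + u) < lexRank y := by
  refine ⟨t, fun j hj => ?_, ?_⟩
  · show ((y + u) j).val = (y j).val
    rw [Pi.add_apply, hz j hj, add_zero]
  · show ((y + u) t).val < (y t).val
    have hu1 : u t = 1 := (zmod2_eq_zero_or_one (u t)).resolve_left hu
    have hy1 : y t = 1 := (zmod2_eq_zero_or_one (y t)).resolve_left hy
    rw [Pi.add_apply, hy1, hu1, ZMod.val_one]
    show ((1 : ZMod 2) + 1).val < 1
    decide

end Summit.PneNP.PneNP.Theorems.ClusHilbert
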